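import Literature.MathematicalPhysics.PowerSystems.DroopMicrogridRegionOfAttraction

/-!
# The droop microgrid with `Q–V` voltage dynamics on a LOSSY network: invariance of the positive
# voltage orthant and global boundedness of all trajectories
# (Schiffer–Ortega–Astolfi–Raisch–Sezi 2014, §4 Proposition 4.2 AS PRINTED — with conductances)

Topic `Literature/MathematicalPhysics/PowerSystems`, namespace
`Literature.MathematicalPhysics.PowerSystems`, grouping sub-namespace `DroopLossy` (the parameter
record).  Companion of `DroopMicrogridHamiltonian.lean` (the LOSSLESS port-Hamiltonian model `DroopPH`,
Shin–Zavala 2020 (9) = Schiffer et al. 2014 (9), (1) under Assumption 5.1) and of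
`DroopMicrogridEquilibriumConvergence.lean` §2/§8 (Prop. 4.2 for the lossless model: an invariant
BOX).  0 named facts: every `theorem` is PROVED from Mathlib and the tree.

## The model (the general network of Schiffer et al. §2 / Shin–Zavala (1a)–(1b), (4))

`DroopLossy n` extends `DroopPH n` by a conductance matrix `G`.  The power flows are the general
(lossy) ones, AS PRINTED in the secondary in bus-admittance form
> [(1a)] `P_i = Σ_{j∈N[i]} V_iV_j (G_ij cos θ_ij + B_ij sin θ_ij)`,
> [(1b)] `Q_i = Σ_{j∈N[i]} V_iV_j (G_ij sin θ_ij − B_ij cos θ_ij)`, `G_ij = G_ji := ℜ(Y_ij)`,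
> `B_ij = B_ji := ℑ(Y_ij)`, `θ_ij := θ_i − θ_j`

(Shin–Zavala arXiv:2002.09802 p0003 L28–L35), which are Schiffer et al.'s (1) written with the bus
admittance matrix (`Y^bus_ik = −(G_ik + jB_ik)` for the line between `i` and `k`,
`Y^bus_ii = Ĝ_ii + jB̂_ii + Σ_k (G_ik + jB_ik)` with the shunt admittance `Ĝ_ii + jB̂_ii` of p0004
L23), and the closed loop is (4)/(9) = Schiffer's (7): `θ̇_i = ω̃_i`,
`τ_Pi ω̃̇_i = −ω̃_i − k_Pi(P_i − P^u_i)`, `τ_Qi V̇_i = −V_i − k_Qi(Q_i − Q^u_i)` — the field of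
`DroopPH` with the lossy flows (`field_eq_of_G_eq_zero`: at `G = 0` it IS `DroopPH.field`).
In this dictionary Schiffer's Assumption 4.1 («B_ii ≤ 0 and B_ik ≤ 0», p0007 L5: the SHUNT and the
LINE susceptances are inductive) reads: `B_ij ≥ 0` for `i ≠ j` and `Σ_j B_ij ≤ 0` (row sum =
shunt susceptance); condition (12) reads `Q^u_i > 0` (Remark 4.3, p0007 L37–L39); NOTHING is assumed
about the signs of the conductances — only `G_ij = G_ji`.

## What is proved (Prop. 4.2: «The set M defined in (10) is invariant and all trajectories of (9),
(1) are bounded», p0007 L7; «conditions for global boundedness are given for lossy microgrids»,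
p0003 L7)

* §1 the model, its reduction to `DroopPH` at `G = 0`, componentwise derivatives of solutions;
* §2 **the reactive power losses are nonnegative**: `Σ_i Q_i = −Σ_iΣ_j B_ij cos θ_ij V_iV_j ≥ 0`
  (the conductance terms cancel in the sum because `G` is symmetric and `sin` is odd; the
  susceptance form is `≤ 0` by the tree's `DroopPH.cosForm_nonpos`) — the print's «which are the
  reactive power losses in the network … (2) together with (11) implies that [they are ≥ 0]» (p0007
  L21–L23); and the coupling bounds `|P_i| ≤ V_i Σ_j V_j(|G_ij| + |B_ij|)`,
  `Q_i = V_i q_i`, `|q_i| ≤ Σ_j V_j(|G_ij| + |B_ij|)`;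
* §3 **the invariant region** `S(r, W̄, Ω) = {|ω̃_i| ≤ Ω, V_i ≥ r, Σ_i (τ_Qi/k_Qi) V_i ≤ W̄}` for
  ADMISSIBLE levels (`Admissible`: `r > 0`; top `τ_Qi Σ_j Q^u_j < W̄`; bottom
  `r(1 + k_Qi β_i) < k_Qi Q^u_i`; frequency `k_Pi(ρ_i β_i + |P^u_i|) < Ω`, with the implied voltage
  caps `ρ_i = k_Qi W̄/τ_Qi` and `β_i = Σ_j ρ_j(|G_ij| + |B_ij|)`): along the print's comparison
  function — here the weighted sum `W = Σ_i (τ_Qi/k_Qi) V_i`, whose derivative along (7) is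
  `Ẇ = −Σ_i V_i/k_Qi − Σ_i Q_i + Σ_i Q^u_i ≤ −Σ_i V_i/k_Qi + Σ_i Q^u_i` («If κ₃ = 0 we have
  Ẇ ≤ −κ₁W + κ₂, and the proof follows immediately», p0007 L35; the print's `W`, `Γ`, `κ` are not
  legible in the held copy and a linear `W` suffices) — every face of `S` is a strict barrier, so
  by the tree's finite-barrier lemma `S` is positively invariant (`region_invariant`); every state
  with `V > 0` lies in an admissible region (`exists_admissible`);
* §4 **completeness and uniqueness**: the field is `C¹`; from every state with positive voltages
  there is exactly one forward-global motion, and it stays in an admissible region — voltages in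
  `[r, ρ_i]` with `r > 0`, `|ω̃_i| ≤ Ω`, `|P_i|`, `|Q_i|` bounded (`exists_unique_globalSolution`,
  `exists_region_of_globalSolution`): Prop. 4.2 as a statement about all trajectories.

THREE COLUMNS.  CERTIFIED (theorems): invariance + boundedness + well-posedness for MODEL `M` =
`DroopLossy` (Kron-reduced inverter network WITH transfer and shunt conductances of either sign,
inductive susceptances, first-order filters, constant inputs) and CLASS `C` = all states with
`V > 0`.  NOT CLAIMED: anything about convergence or stability of the lossy model (no energy
function is known with conductances — Schiffer et al. Remark 5.2), load buses, current limits;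
nothing says a converter, microgrid or grid is stable.
-/

noncomputable section

open Real Set Filter Topology Metric Finset

namespace Literature.MathematicalPhysics.PowerSystems

/-- Parameters of the droop-controlled microgrid with `Q–V` dynamics on a LOSSY Kron-reduced
network: the record `DroopPH` (filter time constants `τ_P, τ_Q`, droop gains `k_P, k_Q`, inputs
`P^u, Q^u`, bus susceptance matrix `B`) extended by the bus CONDUCTANCE matrix `G_ij = ℜ(Y_ij)`
(transfer conductances `G_ij`, `i ≠ j`, and self/shunt conductances in `G_ii`).
[cite: ShinZavala2020, §II-A eqs. (1a)–(1b) («G_ij = G_ji := ℜ(Y_ij), B_ij = B_ji := ℑ(Y_ij)»); SchifferEtAl2014, §2 eq. (1) with shunt elements `Ĝ_ii`, `B̂_ii` (p0004 L23)] -/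
structure DroopLossy (n : ℕ) extends DroopPH n where
  /-- conductance matrix `G_ij` of the Kron-reduced network (bus-admittance real part) -/
  G : Fin n → Fin n → ℝ

namespace DroopLossy

open DroopPH (State)

variable {n : ℕ} (N : DroopLossy n)

/-! ## §1 The lossy power flows (1a)–(1b), the closed loop, and the reduction to `DroopPH` -/

/-- Active power injection of the lossy network, AS PRINTED (1a):
`P_i = Σ_j V_iV_j (G_ij cos θ_ij + B_ij sin θ_ij)`. [cite: ShinZavala2020, eq. (1a); SchifferEtAl2014, eq. (1)] -/
def P (θ V : Fin n → ℝ) (i : Fin n) : ℝ :=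
  ∑ j, V i * V j * (N.G i j * cos (θ i - θ j) + N.B i j * sin (θ i - θ j))

/-- Reactive power injection of the lossy network, AS PRINTED (1b):
`Q_i = Σ_j V_iV_j (G_ij sin θ_ij − B_ij cos θ_ij)`. [cite: ShinZavala2020, eq. (1b); SchifferEtAl2014, eq. (1)] -/
def Q (θ V : Fin n → ℝ) (i : Fin n) : ℝ :=
  ∑ j, V i * V j * (N.G i j * sin (θ i - θ j) - N.B i j * cos (θ i - θ j))

/-- The closed loop (4a)–(4d) with the filters, inputs (5) substituted, on the lossy network — the
system (7)/(9), (1) of Schiffer et al.: `θ̇_i = ω̃_i`, `τ_Pi ω̃̇_i = −ω̃_i − k_Pi(P_i − P^u_i)`,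
`τ_Qi V̇_i = −V_i − k_Qi(Q_i − Q^u_i)`. [cite: ShinZavala2020, eqs. (4a)–(4d), (5); SchifferEtAl2014, eqs. (7), (9)] -/
def field (x : State n) : State n :=
  (fun i => x.2.1 i,
   fun i => (-x.2.1 i - N.kP i * (N.P x.1 x.2.2 i - N.Pu i)) / N.τP i,
   fun i => (-x.2.2 i - N.kQ i * (N.Q x.1 x.2.2 i - N.Qu i)) / N.τQ i)

/-- Solutions of the lossy closed loop on a time set `s` (tree convention). [cite: SchifferEtAl2014, eqs. (7), (9)] -/
def IsSolutionOn (γ : ℝ → State n) (s : Set ℝ) : Prop :=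
  ∀ t ∈ s, HasDerivWithinAt γ (N.field (γ t)) s t

/-- At `G = 0` the lossy active power flow is the lossless one of `DroopPH`. [cite: ShinZavala2020, Assumption 1(a) and the flows after (8)] -/
theorem P_eq_of_G_eq_zero (hG : ∀ i j, N.G i j = 0) (θ V : Fin n → ℝ) :
    N.P θ V = N.toDroopPH.P θ V := by
  ext i
  simp only [P, DroopPH.P, hG, zero_mul, zero_add]
  exact Finset.sum_congr rfl fun j _ => by ring

/-- At `G = 0` the lossy reactive power flow is the lossless one of `DroopPH`. [cite: ShinZavala2020, Assumption 1(a) and the flows after (8)] -/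
theorem Q_eq_of_G_eq_zero (hG : ∀ i j, N.G i j = 0) (θ V : Fin n → ℝ) :
    N.Q θ V = N.toDroopPH.Q θ V := by
  ext i
  simp only [Q, DroopPH.Q, hG, zero_mul, zero_sub]
  rw [← Finset.sum_neg_distrib]
  exact Finset.sum_congr rfl fun j _ => by ring

/-- **Reduction**: at `G = 0` the lossy closed loop IS the port-Hamiltonian model (9) of `DroopPH`.
[cite: ShinZavala2020, §III-A (9) under Assumption 1(a)] -/
theorem field_eq_of_G_eq_zero (hG : ∀ i j, N.G i j = 0) : N.field = N.toDroopPH.field := by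
  ext x <;> simp [field, DroopPH.field, N.P_eq_of_G_eq_zero hG, N.Q_eq_of_G_eq_zero hG]

/-- So at `G = 0` the two solution notions coincide. [cite: ShinZavala2020, §III-A (9)] -/
theorem isSolutionOn_iff_of_G_eq_zero (hG : ∀ i j, N.G i j = 0) (γ : ℝ → State n) (s : Set ℝ) :
    N.IsSolutionOn γ s ↔ N.toDroopPH.IsSolutionOn γ s := by
  simp only [IsSolutionOn, DroopPH.IsSolutionOn, N.field_eq_of_G_eq_zero hG]

/-- Componentwise derivatives along a solution: `θ̇_i = ω̃_i`, `ω̃̇_i = (field x).2.1 i`,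
`V̇_i = (field x).2.2 i`. [cite: SchifferEtAl2014, eqs. (7), (9); ShinZavala2020, eqs. (4a)–(4d)] -/
theorem hasDerivWithinAt_components {γ : ℝ → State n} {s : Set ℝ} {t : ℝ}
    (hγ : HasDerivWithinAt γ (N.field (γ t)) s t) (i : Fin n) :
    HasDerivWithinAt (fun τ => (γ τ).1 i) ((γ t).2.1 i) s t ∧
      HasDerivWithinAt (fun τ => (γ τ).2.1 i) ((N.field (γ t)).2.1 i) s t ∧
      HasDerivWithinAt (fun τ => (γ τ).2.2 i) ((N.field (γ t)).2.2 i) s t := by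
  have h1 : HasDerivWithinAt (fun τ => (γ τ).1) (N.field (γ t)).1 s t := by
    simpa using hγ.hasFDerivWithinAt.fst.hasDerivWithinAt
  have h2 : HasDerivWithinAt (fun τ => (γ τ).2) (N.field (γ t)).2 s t := by
    simpa using hγ.hasFDerivWithinAt.snd.hasDerivWithinAt
  have h21 : HasDerivWithinAt (fun τ => (γ τ).2.1) (N.field (γ t)).2.1 s t := by
    simpa using h2.hasFDerivWithinAt.fst.hasDerivWithinAt
  have h22 : HasDerivWithinAt (fun τ => (γ τ).2.2) (N.field (γ t)).2.2 s t := by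
    simpa using h2.hasFDerivWithinAt.snd.hasDerivWithinAt
  have h1i := (hasDerivWithinAt_pi.1 h1) i
  exact ⟨by simpa [field] using h1i, (hasDerivWithinAt_pi.1 h21) i, (hasDerivWithinAt_pi.1 h22) i⟩

/-! ## §2 The reactive power losses are nonnegative; coupling bounds -/

/-- **The conductance terms cancel in the total reactive power**: for symmetric `G`,
`Σ_i Q_i = −Σ_iΣ_j B_ij cos θ_ij V_iV_j` (the `G_ij sin θ_ij V_iV_j` are odd under `i ↔ j`).
[cite: SchifferEtAl2014, proof of Prop. 4.2 («we have used the fact that, as [B_ik = B_ki] … which are the reactive power losses in the network», p0007 L19–L21)] -/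
theorem sum_Q_eq (hG : ∀ i j, N.G i j = N.G j i) (θ V : Fin n → ℝ) :
    ∑ i, N.Q θ V i = -∑ i, ∑ j, N.B i j * cos (θ i - θ j) * V i * V j := by
  set S : ℝ := ∑ i, ∑ j, V i * V j * N.G i j * sin (θ i - θ j) with hS
  have hS0 : S = 0 := by
    have hswap : S = -S :=
      calc S = ∑ j, ∑ i, V i * V j * N.G i j * sin (θ i - θ j) := by rw [hS, Finset.sum_comm]
        _ = ∑ j, ∑ i, -(V j * V i * N.G j i * sin (θ j - θ i)) := by
          refine Finset.sum_congr rfl fun j _ => Finset.sum_congr rfl fun i _ => ?_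
          rw [hG j i, show sin (θ j - θ i) = -sin (θ i - θ j) by rw [← Real.sin_neg, neg_sub]]
          ring
        _ = -S := by simp only [Finset.sum_neg_distrib, hS]
    linarith
  have h1 : ∑ i, N.Q θ V i = S - ∑ i, ∑ j, N.B i j * cos (θ i - θ j) * V i * V j := by
    rw [hS, ← Finset.sum_sub_distrib]
    refine Finset.sum_congr rfl fun i _ => ?_
    rw [Q, ← Finset.sum_sub_distrib]
    exact Finset.sum_congr rfl fun j _ => by ring
  rw [h1, hS0, zero_sub]

/-- **The reactive power losses `Σ_i Q_i` are nonnegative** on a network with symmetric `G`,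
symmetric dominantly inductive `B` (`B_ij ≥ 0` off-diagonal, `Σ_j B_ij ≤ 0` — Assumption 4.1), at
EVERY state (any signs of `V`, any conductances).
[cite: SchifferEtAl2014, proof of Prop. 4.2 («(2) together with (11) implies that …», p0007 L21–L23) with Assumption 4.1] -/
theorem sum_Q_nonneg (hG : ∀ i j, N.G i j = N.G j i) (hB : ∀ i j, N.B i j = N.B j i)
    (hBoff : ∀ i j, i ≠ j → 0 ≤ N.B i j) (hBrow : ∀ i, ∑ j, N.B i j ≤ 0) (θ V : Fin n → ℝ) :
    0 ≤ ∑ i, N.Q θ V i := by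
  rw [N.sum_Q_eq hG]
  have := N.toDroopPH.cosForm_nonpos hB hBoff hBrow θ V
  linarith

/-- The reduced reactive coupling `q_i = Σ_j V_j (G_ij sin θ_ij − B_ij cos θ_ij)`, so that
`Q_i = V_i q_i`. [cite: ShinZavala2020, eq. (1b)] -/
def qred (θ V : Fin n → ℝ) (i : Fin n) : ℝ :=
  ∑ j, V j * (N.G i j * sin (θ i - θ j) - N.B i j * cos (θ i - θ j))

/-- `Q_i = V_i q_i`. [cite: ShinZavala2020, eq. (1b)] -/
theorem Q_eq_mul_qred (θ V : Fin n → ℝ) (i : Fin n) : N.Q θ V i = V i * N.qred θ V i := by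
  rw [Q, qred, Finset.mul_sum]
  exact Finset.sum_congr rfl fun j _ => by ring

omit N in
/-- `|G cos φ + B sin φ| ≤ |G| + |B|`. [folklore] -/
private theorem abs_Gcos_add_Bsin_le (G B φ : ℝ) : |G * cos φ + B * sin φ| ≤ |G| + |B| := by
  calc |G * cos φ + B * sin φ| ≤ |G * cos φ| + |B * sin φ| := abs_add_le _ _
    _ ≤ |G| + |B| := by
      rw [abs_mul, abs_mul]
      exact add_le_add (mul_le_of_le_one_right (abs_nonneg _) (Real.abs_cos_le_one _))
        (mul_le_of_le_one_right (abs_nonneg _) (Real.abs_sin_le_one _))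

omit N in
/-- `|G sin φ − B cos φ| ≤ |G| + |B|`. [folklore] -/
private theorem abs_Gsin_sub_Bcos_le (G B φ : ℝ) : |G * sin φ - B * cos φ| ≤ |G| + |B| := by
  calc |G * sin φ - B * cos φ| ≤ |G * sin φ| + |B * cos φ| := abs_sub _ _
    _ ≤ |G| + |B| := by
      rw [abs_mul, abs_mul]
      exact add_le_add (mul_le_of_le_one_right (abs_nonneg _) (Real.abs_sin_le_one _))
        (mul_le_of_le_one_right (abs_nonneg _) (Real.abs_cos_le_one _))

/-- **Reactive coupling bound**: `|q_i| ≤ Σ_j ρ_j(|G_ij| + |B_ij|)` when `0 ≤ V_j ≤ ρ_j`. [cite: SchifferEtAl2014, proof of Prop. 4.2 («V ∈ L_∞ … implies that P ∈ L_∞»)] -/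
theorem abs_qred_le {θ V ρ : Fin n → ℝ} (hV : ∀ j, 0 ≤ V j ∧ V j ≤ ρ j) (i : Fin n) :
    |N.qred θ V i| ≤ ∑ j, ρ j * (|N.G i j| + |N.B i j|) := by
  refine (Finset.abs_sum_le_sum_abs _ _).trans (Finset.sum_le_sum fun j _ => ?_)
  rw [abs_mul, abs_of_nonneg (hV j).1]
  exact mul_le_mul (hV j).2 (abs_Gsin_sub_Bcos_le _ _ _) (abs_nonneg _)
    ((hV j).1.trans (hV j).2)

/-- **Active power bound**: `|P_i| ≤ ρ_i Σ_j ρ_j(|G_ij| + |B_ij|)` when `0 ≤ V_j ≤ ρ_j`. [cite: SchifferEtAl2014, proof of Prop. 4.2 («V ∈ L_∞ … implies that P ∈ L_∞»)] -/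
theorem abs_P_le {θ V ρ : Fin n → ℝ} (hV : ∀ j, 0 ≤ V j ∧ V j ≤ ρ j) (i : Fin n) :
    |N.P θ V i| ≤ ρ i * ∑ j, ρ j * (|N.G i j| + |N.B i j|) := by
  have h1 : N.P θ V i = V i * ∑ j, V j * (N.G i j * cos (θ i - θ j) + N.B i j * sin (θ i - θ j)) := by
    rw [P, Finset.mul_sum]
    exact Finset.sum_congr rfl fun j _ => by ring
  have h2 : |∑ j, V j * (N.G i j * cos (θ i - θ j) + N.B i j * sin (θ i - θ j))|
      ≤ ∑ j, ρ j * (|N.G i j| + |N.B i j|) := by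
    refine (Finset.abs_sum_le_sum_abs _ _).trans (Finset.sum_le_sum fun j _ => ?_)
    rw [abs_mul, abs_of_nonneg (hV j).1]
    exact mul_le_mul (hV j).2 (abs_Gcos_add_Bsin_le _ _ _) (abs_nonneg _)
      ((hV j).1.trans (hV j).2)
  rw [h1, abs_mul, abs_of_nonneg (hV i).1]
  exact mul_le_mul (hV i).2 h2 (abs_nonneg _) ((hV i).1.trans (hV i).2)

/-! ## §3 The invariant region of Proposition 4.2 (lossy network): `V_i ≥ r`,
`Σ_i (τ_Qi/k_Qi) V_i ≤ W̄`, `|ω̃_i| ≤ Ω` -/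

/-- The weights `c_i = τ_Qi/k_Qi` of the comparison function. [cite: SchifferEtAl2014, proof of Prop. 4.2 («define the matrix Γ := diag(…)», p0007 L17)] -/
def cQ (i : Fin n) : ℝ := N.τQ i / N.kQ i

/-- The comparison function `W(V) = Σ_i (τ_Qi/k_Qi) V_i` (a weighted `ℓ¹` form; the print's `W` is
built from the same weights `Γ`). [cite: SchifferEtAl2014, proof of Prop. 4.2 (p0007 L17–L35)] -/
def Wsum (V : Fin n → ℝ) : ℝ := ∑ i, N.cQ i * V i

/-- The voltage cap implied by `W ≤ W̄`: `ρ_i = k_Qi W̄/τ_Qi = W̄/c_i`. [cite: SchifferEtAl2014, proof of Prop. 4.2 («V ∈ L_∞»)] -/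
def vcap (Wb : ℝ) (i : Fin n) : ℝ := N.kQ i * Wb / N.τQ i

/-- The coupling bound `β_i = Σ_j ρ_j (|G_ij| + |B_ij|)` at the voltage caps. [cite: SchifferEtAl2014, proof of Prop. 4.2 («P ∈ L_∞»)] -/
def βL (Wb : ℝ) (i : Fin n) : ℝ := ∑ j, N.vcap Wb j * (|N.G i j| + |N.B i j|)

/-- **The region** `S(r, W̄, Ω) = {x = (θ, ω̃, V) : |ω̃_i| ≤ Ω, r ≤ V_i, Σ_i (τ_Qi/k_Qi)V_i ≤ W̄}`
(angles free). [cite: SchifferEtAl2014, Prop. 4.2 («V ∈ L_∞ … ω ∈ L_∞»)] -/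
def region (r Wb Ω : ℝ) : Set (State n) :=
  {x | (∀ i, |x.2.1 i| ≤ Ω) ∧ (∀ i, r ≤ x.2.2 i) ∧ N.Wsum x.2.2 ≤ Wb}

/-- **Admissible levels** `(r, W̄, Ω)` for the lossy model: `r > 0`; (top) `τ_Qi Σ_j Q^u_j < W̄`
for every `i`; (bottom) `r(1 + k_Qi β_i) < k_Qi Q^u_i`; (frequency) `k_Pi(ρ_i β_i + |P^u_i|) < Ω`.
For `k, τ > 0` and `Q^u_i > 0` (condition (12)) every state with `V > 0` lies in the region of
some admissible triple (`exists_admissible`). [cite: SchifferEtAl2014, Prop. 4.2 and its proof («Ẇ ≤ −κ₁W + κ₂»; (12))] -/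
structure Admissible (r Wb Ω : ℝ) : Prop where
  r_pos : 0 < r
  top : ∀ i, N.τQ i * ∑ j, N.Qu j < Wb
  bottom : ∀ i, r * (1 + N.kQ i * N.βL Wb i) < N.kQ i * N.Qu i
  freq : ∀ i, N.kP i * (N.vcap Wb i * N.βL Wb i + |N.Pu i|) < Ω

/-- Inside the region the voltages are capped: `0 ≤ V_i ≤ ρ_i` (`k_Q, τ_Q > 0`, `r > 0`). [cite: SchifferEtAl2014, proof of Prop. 4.2 («hence, together with (15), V ∈ L_∞», p0007 L29)] -/
theorem voltage_le_vcap (hkQ : ∀ i, 0 < N.kQ i) (hτQ : ∀ i, 0 < N.τQ i) {r Wb Ω : ℝ} (hr : 0 < r)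
    {x : State n} (hx : x ∈ N.region r Wb Ω) (i : Fin n) :
    0 ≤ x.2.2 i ∧ x.2.2 i ≤ N.vcap Wb i := by
  obtain ⟨-, hV, hW⟩ := hx
  have hc : ∀ j, 0 < N.cQ j := fun j => div_pos (hτQ j) (hkQ j)
  have h0 : ∀ j, 0 ≤ x.2.2 j := fun j => hr.le.trans (hV j)
  have h1 : N.cQ i * x.2.2 i ≤ N.Wsum x.2.2 :=
    Finset.single_le_sum (fun j _ => mul_nonneg (hc j).le (h0 j)) (Finset.mem_univ i)
  refine ⟨h0 i, ?_⟩
  rw [vcap, le_div_iff₀ (hτQ i)]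
  have h2 : N.cQ i * x.2.2 i ≤ Wb := h1.trans hW
  rw [cQ, div_mul_eq_mul_div, div_le_iff₀ (hkQ i)] at h2
  linarith

/-- **PROPOSITION 4.2 (Schiffer–Ortega–Astolfi–Raisch–Sezi 2014), invariance form, LOSSY network.**
For positive gains and time constants, symmetric conductances `G`, a symmetric dominantly inductive
susceptance matrix (`B_ij ≥ 0` off-diagonal, `Σ_j B_ij ≤ 0` — Assumption 4.1) and admissible levels
`(r, W̄, Ω)`, every solution of the lossy closed loop on `[0, T]` starting in `S(r, W̄, Ω)` stays in
it: the voltages stay `≥ r > 0` and below the caps `ρ_i`, the frequency deviations in `[−Ω, Ω]`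
(«The set M defined in (10) is invariant and all trajectories of (9), (1) are bounded»).  Proof by
strict barriers on the faces (tree `forall_le_of_hasDerivWithinAt_of_eq_imp_deriv_neg`): on
`W = W̄`, `Ẇ = −Σ V_i/k_Qi − Σ Q_i + Σ Q^u_i < 0` because the reactive losses `Σ Q_i` are `≥ 0`
(`sum_Q_nonneg`) and `Σ V_i/k_Qi = Σ c_iV_i/τ_Qi > Σ Q^u_i` by (top); on `V_i = r`,
`τ_Qi V̇_i = −r − k_Qi r q_i + k_Qi Q^u_i > 0` by `|q_i| ≤ β_i` and (bottom); on `ω̃_i = ±Ω` by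
`|P_i| ≤ ρ_i β_i` and (frequency).
[cite: SchifferEtAl2014, §4 Proposition 4.2 with Assumption 4.1 and (12) (p0007 L5–L35); Khalil2002, Lemma 3.4 (comparison)] -/
theorem region_invariant (hG : ∀ i j, N.G i j = N.G j i) (hB : ∀ i j, N.B i j = N.B j i)
    (hkP : ∀ i, 0 < N.kP i) (hτP : ∀ i, 0 < N.τP i) (hkQ : ∀ i, 0 < N.kQ i)
    (hτQ : ∀ i, 0 < N.τQ i) (hBoff : ∀ i j, i ≠ j → 0 ≤ N.B i j) (hBrow : ∀ i, ∑ j, N.B i j ≤ 0)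
    {r Wb Ω : ℝ} (hadm : N.Admissible r Wb Ω) {X : ℝ → State n} {T : ℝ}
    (hX : N.IsSolutionOn X (Icc 0 T)) (h0 : X 0 ∈ N.region r Wb Ω) :
    ∀ t ∈ Icc 0 T, X t ∈ N.region r Wb Ω := by
  rcases Nat.eq_zero_or_pos n with hn | hn
  · subst hn
    intro t _
    have : X t = X 0 := Subsingleton.elim _ _
    rw [this]; exact h0
  haveI : Nonempty (Fin n) := ⟨⟨0, hn⟩⟩
  have hr := hadm.r_pos
  have hc : ∀ j, 0 < N.cQ j := fun j => div_pos (hτQ j) (hkQ j)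
  -- the `2n + 1 + n`... constraints: `W ≤ W̄` | `−V_i ≤ −r` | `ω̃_i ≤ Ω` | `−ω̃_i ≤ Ω`
  let h : (Unit ⊕ Fin n) ⊕ (Fin n ⊕ Fin n) → ℝ → ℝ :=
    Sum.elim (Sum.elim (fun _ t => N.Wsum (X t).2.2) (fun i t => -(X t).2.2 i))
      (Sum.elim (fun i t => (X t).2.1 i) (fun i t => -(X t).2.1 i))
  let h' : (Unit ⊕ Fin n) ⊕ (Fin n ⊕ Fin n) → ℝ → ℝ :=
    Sum.elim (Sum.elim (fun _ t => ∑ i, N.cQ i * (N.field (X t)).2.2 i)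
        (fun i t => -(N.field (X t)).2.2 i))
      (Sum.elim (fun i t => (N.field (X t)).2.1 i) (fun i t => -(N.field (X t)).2.1 i))
  let c : (Unit ⊕ Fin n) ⊕ (Fin n ⊕ Fin n) → ℝ :=
    Sum.elim (Sum.elim (fun _ => Wb) (fun _ => -r)) (Sum.elim (fun _ => Ω) (fun _ => Ω))
  have hder : ∀ k, ∀ t ∈ Icc 0 T, HasDerivWithinAt (h k) (h' k t) (Icc 0 T) t := by
    rintro ((u|i)|(i|i)) t ht
    · show HasDerivWithinAt (fun t => N.Wsum (X t).2.2) (∑ i, N.cQ i * (N.field (X t)).2.2 i)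
        (Icc 0 T) t
      simp only [Wsum]
      exact HasDerivWithinAt.fun_sum fun i _ =>
        ((N.hasDerivWithinAt_components (hX t ht) i).2.2).const_mul _
    · exact (N.hasDerivWithinAt_components (hX t ht) i).2.2.neg
    · exact (N.hasDerivWithinAt_components (hX t ht) i).2.1
    · exact (N.hasDerivWithinAt_components (hX t ht) i).2.1.neg
  have hall : ∀ t, (∀ j, h j t ≤ c j) ↔ X t ∈ N.region r Wb Ω := by
    intro t
    constructor
    · intro hj
      refine ⟨fun i => abs_le.2 ⟨?_, ?_⟩, fun i => ?_, ?_⟩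
      · have := hj (Sum.inr (Sum.inr i)); simp only [h, c, Sum.elim_inr] at this; linarith
      · have := hj (Sum.inr (Sum.inl i)); simpa [h, c] using this
      · have := hj (Sum.inl (Sum.inr i)); simp only [h, c, Sum.elim_inl, Sum.elim_inr] at this
        linarith
      · have := hj (Sum.inl (Sum.inl ())); simpa [h, c] using this
    · rintro ⟨hω, hV, hW⟩ ((u|i)|(i|i))
      · simpa [h, c] using hW
      · simp only [h, c, Sum.elim_inl, Sum.elim_inr]; linarith [hV i]
      · simpa [h, c] using (abs_le.1 (hω i)).2
      · simp only [h, c, Sum.elim_inr]; linarith [(abs_le.1 (hω i)).1]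
  have hface : ∀ t ∈ Icc 0 T, (∀ j, h j t ≤ c j) → ∀ k, h k t = c k → h' k t < 0 := by
    intro t ht hj
    have hx := (hall t).1 hj
    have hVcap : ∀ j, 0 ≤ (X t).2.2 j ∧ (X t).2.2 j ≤ N.vcap Wb j :=
      N.voltage_le_vcap hkQ hτQ hr hx
    obtain ⟨hω, hV, hW⟩ := hx
    have hq : ∀ i, |N.qred (X t).1 (X t).2.2 i| ≤ N.βL Wb i := fun i => N.abs_qred_le hVcap i
    have hP : ∀ i, |N.P (X t).1 (X t).2.2 i| ≤ N.vcap Wb i * N.βL Wb i := fun i => N.abs_P_le hVcap i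
    rintro ((u|i)|(i|i)) hact
    · -- face `W = W̄`
      have hWeq : N.Wsum (X t).2.2 = Wb := by simpa [h, c] using hact
      show ∑ i, N.cQ i * (N.field (X t)).2.2 i < 0
      have h1 : ∑ i, N.cQ i * (N.field (X t)).2.2 i
          = -∑ i, N.cQ i * (X t).2.2 i / N.τQ i - ∑ i, N.Q (X t).1 (X t).2.2 i + ∑ i, N.Qu i := by
        rw [← Finset.sum_neg_distrib, ← Finset.sum_sub_distrib, ← Finset.sum_add_distrib]
        refine Finset.sum_congr rfl fun i _ => ?_
        simp only [field, cQ]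
        field_simp [(hkQ i).ne', (hτQ i).ne']
        ring
      have h2 := N.sum_Q_nonneg hG hB hBoff hBrow (X t).1 (X t).2.2
      -- `Σ c_iV_i/τ_Qi > Σ Q^u`: termwise `c_iV_i (W̄/τ_Qi) > c_iV_i ΣQ^u` and `Σ c_iV_i = W̄ > 0`
      have hWpos : 0 < Wb := by
        rw [← hWeq, Wsum]
        exact Finset.sum_pos (fun i _ => mul_pos (hc i) (lt_of_lt_of_le hr (hV i)))
          Finset.univ_nonempty
      have h3 : Wb * ∑ j, N.Qu j < Wb * ∑ i, N.cQ i * (X t).2.2 i / N.τQ i := by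
        calc Wb * ∑ j, N.Qu j = ∑ i, N.cQ i * (X t).2.2 i * ∑ j, N.Qu j := by
              rw [← Finset.sum_mul, ← Wsum, hWeq]
          _ < ∑ i, N.cQ i * (X t).2.2 i * (Wb / N.τQ i) := by
              refine Finset.sum_lt_sum_of_nonempty Finset.univ_nonempty fun i _ => ?_
              have hpos : 0 < N.cQ i * (X t).2.2 i := mul_pos (hc i) (lt_of_lt_of_le hr (hV i))
              refine mul_lt_mul_of_pos_left ?_ hpos
              rw [lt_div_iff₀ (hτQ i), mul_comm]
              exact hadm.top i
          _ = Wb * ∑ i, N.cQ i * (X t).2.2 i / N.τQ i := by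
              rw [Finset.mul_sum]
              exact Finset.sum_congr rfl fun i _ => by ring
      have h4 : ∑ j, N.Qu j < ∑ i, N.cQ i * (X t).2.2 i / N.τQ i := lt_of_mul_lt_mul_left h3 hWpos.le
      rw [h1]
      linarith
    · -- face `V_i = r`
      have hVi : (X t).2.2 i = r := by
        have : -(X t).2.2 i = -r := by simpa [h, c] using hact
        linarith
      show -(N.field (X t)).2.2 i < 0
      rw [neg_lt_zero]
      simp only [field]
      apply div_pos _ (hτQ i)
      rw [N.Q_eq_mul_qred, hVi]
      have h1 := (abs_le.1 (hq i)).2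
      have h2 : N.kQ i * (r * N.qred (X t).1 (X t).2.2 i) ≤ N.kQ i * (r * N.βL Wb i) :=
        mul_le_mul_of_nonneg_left (mul_le_mul_of_nonneg_left h1 hr.le) (hkQ i).le
      have h3 := hadm.bottom i
      nlinarith [h2, h3]
    · -- face `ω̃_i = Ω`
      have hωi : (X t).2.1 i = Ω := by simpa [h, c] using hact
      show (N.field (X t)).2.1 i < 0
      simp only [field]
      apply div_neg_of_neg_of_pos _ (hτP i)
      rw [hωi]
      have h1 := (abs_le.1 (hP i)).1
      have h2 := le_abs_self (N.Pu i)
      have h3 : N.kP i * (N.Pu i - N.P (X t).1 (X t).2.2 i)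
          ≤ N.kP i * (N.vcap Wb i * N.βL Wb i + |N.Pu i|) :=
        mul_le_mul_of_nonneg_left (by linarith) (hkP i).le
      have h4 := hadm.freq i
      nlinarith [h3, h4]
    · -- face `ω̃_i = −Ω`
      have hωi : (X t).2.1 i = -Ω := by
        have : -(X t).2.1 i = Ω := by simpa [h, c] using hact
        linarith
      show -(N.field (X t)).2.1 i < 0
      rw [neg_lt_zero]
      simp only [field]
      apply div_pos _ (hτP i)
      rw [hωi]
      have h1 := (abs_le.1 (hP i)).2
      have h2 := neg_abs_le (N.Pu i)
      have h3 : N.kP i * (N.P (X t).1 (X t).2.2 i - N.Pu i)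
          ≤ N.kP i * (N.vcap Wb i * N.βL Wb i + |N.Pu i|) :=
        mul_le_mul_of_nonneg_left (by linarith) (hkP i).le
      have h4 := hadm.freq i
      nlinarith [h3, h4]
  have hres := Literature.Analysis.ODE.forall_le_of_hasDerivWithinAt_of_eq_imp_deriv_neg
    hder hface ((hall 0).2 h0)
  exact fun t ht => (hall t).1 (hres t ht)

/-- `β_i ≥ 0` when `W̄ ≥ 0` (`k_Q, τ_Q > 0`). [folklore] -/
private theorem βL_nonneg (hkQ : ∀ i, 0 < N.kQ i) (hτQ : ∀ i, 0 < N.τQ i) {Wb : ℝ} (hWb : 0 ≤ Wb)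
    (i : Fin n) : 0 ≤ N.βL Wb i :=
  Finset.sum_nonneg fun j _ => mul_nonneg
    (div_nonneg (mul_nonneg (hkQ j).le hWb) (hτQ j).le) (add_nonneg (abs_nonneg _) (abs_nonneg _))

/-- **Every state with positive voltages lies in an admissible region** (`k_P, k_Q, τ_Q > 0`,
`Q^u_i > 0` — condition (12)): Prop. 4.2's window exists for every initial condition of the phase
space `ℝⁿ × ℝⁿ × ℝⁿ_{>0}`, whatever the conductances. [cite: SchifferEtAl2014, Prop. 4.2 and Remark 4.3 (condition (12))] -/
theorem exists_admissible (hkP : ∀ i, 0 < N.kP i) (hkQ : ∀ i, 0 < N.kQ i) (hτQ : ∀ i, 0 < N.τQ i)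
    (hQu : ∀ i, 0 < N.Qu i) (x : State n) (hx : ∀ i, 0 < x.2.2 i) :
    ∃ r Wb Ω : ℝ, N.Admissible r Wb Ω ∧ x ∈ N.region r Wb Ω := by
  have hc : ∀ j, 0 < N.cQ j := fun j => div_pos (hτQ j) (hkQ j)
  -- the top level
  set Wb : ℝ := 1 + N.Wsum x.2.2 + ∑ i, N.τQ i * |∑ j, N.Qu j| with hWb
  have hWsum : 0 ≤ N.Wsum x.2.2 := Finset.sum_nonneg fun j _ => mul_nonneg (hc j).le (hx j).le
  have hτterm : ∀ i, 0 ≤ N.τQ i * |∑ j, N.Qu j| := fun i => mul_nonneg (hτQ i).le (abs_nonneg _)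
  have hτsum : 0 ≤ ∑ i, N.τQ i * |∑ j, N.Qu j| := Finset.sum_nonneg fun i _ => hτterm i
  have hWb0 : 0 ≤ Wb := by rw [hWb]; linarith
  have htop : ∀ i, N.τQ i * ∑ j, N.Qu j < Wb := fun i => by
    have h1 : N.τQ i * ∑ j, N.Qu j ≤ N.τQ i * |∑ j, N.Qu j| :=
      mul_le_mul_of_nonneg_left (le_abs_self _) (hτQ i).le
    have h2 : N.τQ i * |∑ j, N.Qu j| ≤ ∑ k, N.τQ k * |∑ j, N.Qu j| :=
      Finset.single_le_sum (fun k _ => hτterm k) (Finset.mem_univ i)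
    rw [hWb]; linarith
  have hβ : ∀ i, 0 ≤ N.βL Wb i := N.βL_nonneg hkQ hτQ hWb0
  -- the bottom level
  set D : ℝ := 1 + ∑ i, (1 / x.2.2 i + (1 + N.kQ i * N.βL Wb i) / (N.kQ i * N.Qu i)) with hD
  have hDterm : ∀ i, 0 ≤ 1 / x.2.2 i + (1 + N.kQ i * N.βL Wb i) / (N.kQ i * N.Qu i) := fun i =>
    add_nonneg (div_nonneg zero_le_one (hx i).le)
      (div_nonneg (by nlinarith [hβ i, hkQ i]) (mul_nonneg (hkQ i).le (hQu i).le))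
  have hDi : ∀ i, 1 / x.2.2 i + (1 + N.kQ i * N.βL Wb i) / (N.kQ i * N.Qu i) ≤ D - 1 := fun i => by
    rw [hD, add_sub_cancel_left]
    exact Finset.single_le_sum (fun k _ => hDterm k) (Finset.mem_univ i)
  have hD1 : 1 ≤ D := by
    have := Finset.sum_nonneg fun k (_ : k ∈ Finset.univ) => hDterm k
    rw [hD]; linarith
  have hDpos : 0 < D := by linarith
  set r : ℝ := 1 / D with hr
  have hrpos : 0 < r := by rw [hr]; positivity
  -- the frequency level
  set Ω : ℝ := 1 + ∑ i, (|x.2.1 i| + N.kP i * (N.vcap Wb i * N.βL Wb i + |N.Pu i|)) with hΩ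
  have hΩterm : ∀ i, 0 ≤ |x.2.1 i| + N.kP i * (N.vcap Wb i * N.βL Wb i + |N.Pu i|) := fun i =>
    add_nonneg (abs_nonneg _) (mul_nonneg (hkP i).le (add_nonneg (mul_nonneg
      (div_nonneg (mul_nonneg (hkQ i).le hWb0) (hτQ i).le) (hβ i)) (abs_nonneg _)))
  have hΩi : ∀ i, |x.2.1 i| + N.kP i * (N.vcap Wb i * N.βL Wb i + |N.Pu i|) ≤ Ω - 1 := fun i => by
    rw [hΩ, add_sub_cancel_left]
    exact Finset.single_le_sum (fun k _ => hΩterm k) (Finset.mem_univ i)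
  refine ⟨r, Wb, Ω, ⟨hrpos, htop, fun i => ?_, fun i => ?_⟩, fun i => ?_, fun i => ?_, ?_⟩
  · -- bottom: `r (1 + k β) < k Q^u` since `(1 + k β)/(k Q^u) ≤ D − 1 < D = 1/r`
    have hkQu : 0 < N.kQ i * N.Qu i := mul_pos (hkQ i) (hQu i)
    have h1 : (1 + N.kQ i * N.βL Wb i) / (N.kQ i * N.Qu i) < D := by
      have := hDi i
      have : 0 ≤ 1 / x.2.2 i := div_nonneg zero_le_one (hx i).le
      linarith
    rw [div_lt_iff₀ hkQu] at h1
    rw [hr, one_div, ← div_eq_inv_mul, div_lt_iff₀ hDpos]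
    linarith
  · have := hΩi i; have := abs_nonneg (x.2.1 i); linarith
  · -- `|ω̃_i| ≤ Ω`
    have := hΩi i
    have : 0 ≤ N.kP i * (N.vcap Wb i * N.βL Wb i + |N.Pu i|) :=
      mul_nonneg (hkP i).le (add_nonneg (mul_nonneg
        (div_nonneg (mul_nonneg (hkQ i).le hWb0) (hτQ i).le) (hβ i)) (abs_nonneg _))
    linarith
  · -- `r = 1/D ≤ V_i`
    have h1 : 1 / x.2.2 i < D := by
      have := hDi i
      have : 0 ≤ (1 + N.kQ i * N.βL Wb i) / (N.kQ i * N.Qu i) :=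
        div_nonneg (by nlinarith [hβ i, hkQ i]) (mul_nonneg (hkQ i).le (hQu i).le)
      linarith
    rw [hr]
    rw [div_lt_iff₀ (hx i)] at h1
    rw [div_le_iff₀ hDpos]
    linarith
  · -- `W(V) ≤ W̄`
    show N.Wsum x.2.2 ≤ Wb
    rw [hWb]; linarith

/-! ## §4 Completeness and uniqueness: every state with positive voltages has exactly one
forward-global motion, and it is bounded (Prop. 4.2 as a statement about all trajectories) -/

/-- The lossy active power flow is `C¹` in the state. [folklore] -/
private theorem contDiff_P (i : Fin n) : ContDiff ℝ 1 fun x : State n => N.P x.1 x.2.2 i := by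
  have hθ : ∀ k, ContDiff ℝ 1 fun x : State n => x.1 k := fun k =>
    (contDiff_apply ℝ ℝ k).comp contDiff_fst
  have hV : ∀ k, ContDiff ℝ 1 fun x : State n => x.2.2 k := fun k =>
    (contDiff_apply ℝ ℝ k).comp (contDiff_snd.comp contDiff_snd)
  unfold P
  exact ContDiff.sum fun j _ => ((hV i).mul (hV j)).mul
    ((contDiff_const.mul ((hθ i).sub (hθ j)).cos).add (contDiff_const.mul ((hθ i).sub (hθ j)).sin))

/-- The lossy reactive power flow is `C¹` in the state. [folklore] -/
private theorem contDiff_Q (i : Fin n) : ContDiff ℝ 1 fun x : State n => N.Q x.1 x.2.2 i := by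
  have hθ : ∀ k, ContDiff ℝ 1 fun x : State n => x.1 k := fun k =>
    (contDiff_apply ℝ ℝ k).comp contDiff_fst
  have hV : ∀ k, ContDiff ℝ 1 fun x : State n => x.2.2 k := fun k =>
    (contDiff_apply ℝ ℝ k).comp (contDiff_snd.comp contDiff_snd)
  unfold Q
  exact ContDiff.sum fun j _ => ((hV i).mul (hV j)).mul
    ((contDiff_const.mul ((hθ i).sub (hθ j)).sin).sub (contDiff_const.mul ((hθ i).sub (hθ j)).cos))

/-- **The lossy closed loop is a `C¹` field** (polynomial–trigonometric). [cite: SchifferEtAl2014, eqs. (7), (9), (1)] -/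
theorem contDiff_field : ContDiff ℝ 1 N.field := by
  have hω : ∀ k, ContDiff ℝ 1 fun x : State n => x.2.1 k := fun k =>
    (contDiff_apply ℝ ℝ k).comp (contDiff_fst.comp contDiff_snd)
  have hV : ∀ k, ContDiff ℝ 1 fun x : State n => x.2.2 k := fun k =>
    (contDiff_apply ℝ ℝ k).comp (contDiff_snd.comp contDiff_snd)
  unfold field
  refine (contDiff_pi.2 fun i => hω i).prodMk
    ((contDiff_pi.2 fun i => ?_).prodMk (contDiff_pi.2 fun i => ?_))
  · exact ((hω i).neg.sub (contDiff_const.mul ((N.contDiff_P i).sub contDiff_const))).div_const _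
  · exact ((hV i).neg.sub (contDiff_const.mul ((N.contDiff_Q i).sub contDiff_const))).div_const _

/-- **Solutions of the lossy closed loop are unique**: two solutions on `[0, T]` with the same
initial state coincide (`C¹` field ⇒ Lipschitz on a compact ball containing both trajectories, and
Grönwall). [cite: Khalil2002, Theorem 3.1; RoucheHabetsLaloy1977, Ch. I Thm 6.2 (a)] -/
theorem solution_unique (X Y : ℝ → State n) (T : ℝ) (hX : N.IsSolutionOn X (Icc 0 T))
    (hY : N.IsSolutionOn Y (Icc 0 T)) (h0 : X 0 = Y 0) : ∀ t ∈ Icc (0 : ℝ) T, X t = Y t := by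
  intro t ht
  have hXc : ContinuousOn X (Icc 0 T) := fun s hs => (hX s hs).continuousWithinAt
  have hYc : ContinuousOn Y (Icc 0 T) := fun s hs => (hY s hs).continuousWithinAt
  obtain ⟨RX, hRX⟩ := isCompact_Icc.exists_bound_of_continuousOn hXc
  obtain ⟨RY, hRY⟩ := isCompact_Icc.exists_bound_of_continuousOn hYc
  set K : Set (State n) := closedBall (0 : State n) (max RX RY) with hK
  obtain ⟨Lip, hLip⟩ := Literature.Analysis.ODE.exists_lipschitzOnWith_of_isCompact isOpen_univ
    N.contDiff_field.contDiffOn (isCompact_closedBall _ _) (Set.subset_univ K)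
  have hXK : ∀ s ∈ Icc (0 : ℝ) T, X s ∈ K := fun s hs =>
    mem_closedBall.2 (by rw [dist_zero_right]; exact (hRX s hs).trans (le_max_left _ _))
  have hYK : ∀ s ∈ Icc (0 : ℝ) T, Y s ∈ K := fun s hs =>
    mem_closedBall.2 (by rw [dist_zero_right]; exact (hRY s hs).trans (le_max_right _ _))
  have hd := Literature.Analysis.ODE.dist_le_of_solutions hLip hX hY hXK hYK t ht
  rw [h0, dist_self, zero_mul] at hd
  exact dist_le_zero.1 hd

/-- The compact `(ω̃, V)`-window of the region: `|ω̃_i| ≤ Ω`, `r ≤ V_i`, `Σ c_iV_i ≤ W̄` is closed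
and, for `c_i > 0`, bounded. [folklore] -/
private theorem isCompact_window (hkQ : ∀ i, 0 < N.kQ i) (hτQ : ∀ i, 0 < N.τQ i) {r : ℝ}
    (hr : 0 < r) (Wb Ω : ℝ) :
    IsCompact {p : (Fin n → ℝ) × (Fin n → ℝ) |
      (∀ i, |p.1 i| ≤ Ω) ∧ (∀ i, r ≤ p.2 i) ∧ N.Wsum p.2 ≤ Wb} := by
  -- closed subset of the compact box `|ω̃_i| ≤ Ω`, `r ≤ V_i ≤ ρ_i`
  have hbig : IsCompact ((Set.univ.pi fun _ : Fin n => Icc (-Ω) Ω) ×ˢ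
      (Set.univ.pi fun i : Fin n => Icc r (N.vcap Wb i))) :=
    (isCompact_univ_pi fun _ => isCompact_Icc).prod (isCompact_univ_pi fun _ => isCompact_Icc)
  have hclosed : IsClosed {p : (Fin n → ℝ) × (Fin n → ℝ) |
      (∀ i, |p.1 i| ≤ Ω) ∧ (∀ i, r ≤ p.2 i) ∧ N.Wsum p.2 ≤ Wb} := by
    have hW : Continuous fun p : (Fin n → ℝ) × (Fin n → ℝ) => N.Wsum p.2 := by
      simp only [Wsum]
      exact continuous_finsetSum _ fun i _ =>
        continuous_const.mul ((continuous_apply i).comp continuous_snd)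
    have h1 : IsClosed {p : (Fin n → ℝ) × (Fin n → ℝ) | ∀ i, |p.1 i| ≤ Ω} := by
      have : {p : (Fin n → ℝ) × (Fin n → ℝ) | ∀ i, |p.1 i| ≤ Ω}
          = ⋂ i, {p : (Fin n → ℝ) × (Fin n → ℝ) | |p.1 i| ≤ Ω} := by
        ext p; simp only [mem_setOf_eq, mem_iInter]
      rw [this]
      exact isClosed_iInter fun i =>
        isClosed_le ((continuous_apply i).comp continuous_fst).abs continuous_const
    have h2 : IsClosed {p : (Fin n → ℝ) × (Fin n → ℝ) | ∀ i, r ≤ p.2 i} := by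
      have : {p : (Fin n → ℝ) × (Fin n → ℝ) | ∀ i, r ≤ p.2 i}
          = ⋂ i, {p : (Fin n → ℝ) × (Fin n → ℝ) | r ≤ p.2 i} := by
        ext p; simp only [mem_setOf_eq, mem_iInter]
      rw [this]
      exact isClosed_iInter fun i =>
        isClosed_le continuous_const ((continuous_apply i).comp continuous_snd)
    have h3 : IsClosed {p : (Fin n → ℝ) × (Fin n → ℝ) | N.Wsum p.2 ≤ Wb} :=
      isClosed_le hW continuous_const
    have heq : {p : (Fin n → ℝ) × (Fin n → ℝ) |
        (∀ i, |p.1 i| ≤ Ω) ∧ (∀ i, r ≤ p.2 i) ∧ N.Wsum p.2 ≤ Wb}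
        = {p | ∀ i, |p.1 i| ≤ Ω} ∩ ({p | ∀ i, r ≤ p.2 i} ∩ {p | N.Wsum p.2 ≤ Wb}) := by
      ext p; simp only [mem_setOf_eq, mem_inter_iff]
    rw [heq]
    exact h1.inter (h2.inter h3)
  refine hbig.of_isClosed_subset hclosed ?_
  rintro ⟨ω, V⟩ ⟨hω, hV, hW⟩
  simp only [mem_prod, mem_univ_pi, Set.mem_Icc]
  refine ⟨fun i => abs_le.1 (hω i), fun i => ⟨hV i, ?_⟩⟩
  have hx : ((fun _ => (0 : ℝ), ω, V) : State n) ∈ N.region r Wb Ω := ⟨hω, hV, hW⟩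
  exact (N.voltage_le_vcap hkQ hτQ hr hx i).2

omit N in
/-- The compact cylinder `{|θ_i − θ⁰_i| ≤ ρ} × window`. [folklore] -/
private theorem isCompact_cylinder (θ₀ : Fin n → ℝ) (ρ : ℝ) {Kw : Set ((Fin n → ℝ) × (Fin n → ℝ))}
    (hKw : IsCompact Kw) :
    IsCompact {x : State n | (∀ i, x.1 i ∈ Icc (θ₀ i - ρ) (θ₀ i + ρ)) ∧ x.2 ∈ Kw} := by
  have h : {x : State n | (∀ i, x.1 i ∈ Icc (θ₀ i - ρ) (θ₀ i + ρ)) ∧ x.2 ∈ Kw}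
      = (Set.univ.pi fun i : Fin n => Icc (θ₀ i - ρ) (θ₀ i + ρ)) ×ˢ Kw := by
    ext x; simp only [mem_setOf_eq, mem_prod, mem_univ_pi]
  rw [h]
  exact (isCompact_univ_pi fun _ => isCompact_Icc).prod hKw

/-- **Angles move at most at speed `Ω` inside the region**: `|θ_i(t) − θ_i(0)| ≤ Ω t` along a
solution on `[0, s]` staying in `S(r, W̄, Ω)`. [cite: SchifferEtAl2014, proof of Prop. 4.2 («ω ∈ L_∞»)] -/
theorem abs_angle_sub_le {r Wb Ω : ℝ} {Y : ℝ → State n} {s : ℝ} (hY : N.IsSolutionOn Y (Icc 0 s))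
    (hreg : ∀ t ∈ Icc 0 s, Y t ∈ N.region r Wb Ω) {t : ℝ} (ht : t ∈ Icc 0 s) (i : Fin n) :
    |(Y t).1 i - (Y 0).1 i| ≤ Ω * t := by
  have h := Convex.norm_image_sub_le_of_norm_hasDerivWithin_le (f := fun τ => (Y τ).1 i)
    (f' := fun τ => (Y τ).2.1 i) (s := Icc (0 : ℝ) s) (C := Ω) (fun τ hτ => ?_) (fun τ hτ => ?_)
    (convex_Icc 0 s) (Set.left_mem_Icc.2 (ht.1.trans ht.2)) ht
  · simpa [Real.norm_eq_abs, abs_of_nonneg ht.1] using h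
  · exact (N.hasDerivWithinAt_components (hY τ hτ) i).1
  · rw [Real.norm_eq_abs]
    exact (hreg τ hτ).1 i

/-- **Every state of an admissible region has a forward-global motion of the lossy closed loop** —
a solution on `[0, ∞)` (`IsSolutionOn X [0, T]` for every `T`): the field is `C¹`; on `[0, T]`
every solution from `x₀` is confined (region invariance and `|θ_i(t) − θ_i(0)| ≤ ΩT`) to a
compact cylinder, so a solution on `[0, T]` exists (tree `exists_solution_of_confined`); the
`[0, N]`-solutions agree on overlaps and glue.
[cite: SchifferEtAl2014, Prop. 4.2 (global boundedness, hence completeness); Teschl2012, Cor. 2.15; RoucheHabetsLaloy1977, Ch. I Thm 6.2 (a)] -/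
theorem exists_globalSolution_of_mem_region (hG : ∀ i j, N.G i j = N.G j i)
    (hB : ∀ i j, N.B i j = N.B j i) (hkP : ∀ i, 0 < N.kP i) (hτP : ∀ i, 0 < N.τP i)
    (hkQ : ∀ i, 0 < N.kQ i) (hτQ : ∀ i, 0 < N.τQ i) (hBoff : ∀ i j, i ≠ j → 0 ≤ N.B i j)
    (hBrow : ∀ i, ∑ j, N.B i j ≤ 0) {r Wb Ω : ℝ} (hadm : N.Admissible r Wb Ω) (x₀ : State n)
    (h0 : x₀ ∈ N.region r Wb Ω) :
    ∃ X : ℝ → State n, X 0 = x₀ ∧ ∀ T : ℝ, N.IsSolutionOn X (Icc 0 T) := by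
  have hKw := N.isCompact_window hkQ hτQ hadm.r_pos Wb Ω
  let K : ℝ → Set (State n) := fun T =>
    {x | (∀ i, x.1 i ∈ Icc (x₀.1 i - Ω * T) (x₀.1 i + Ω * T)) ∧
      x.2 ∈ {p : (Fin n → ℝ) × (Fin n → ℝ) |
        (∀ i, |p.1 i| ≤ Ω) ∧ (∀ i, r ≤ p.2 i) ∧ N.Wsum p.2 ≤ Wb}}
  have hK : ∀ T, IsCompact (K T) := fun T => isCompact_cylinder x₀.1 (Ω * T) hKw
  have hconf : ∀ T : ℝ, ∀ s ∈ Icc 0 T, ∀ Y : ℝ → State n, Y 0 = x₀ →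
      N.IsSolutionOn Y (Icc 0 s) → ∀ t ∈ Icc 0 s, Y t ∈ K T := by
    intro T s hs Y hY0 hY t ht
    have hYreg : ∀ τ ∈ Icc 0 s, Y τ ∈ N.region r Wb Ω :=
      N.region_invariant hG hB hkP hτP hkQ hτQ hBoff hBrow hadm hY (by rw [hY0]; exact h0)
    refine ⟨fun i => ?_, hYreg t ht⟩
    have h1 := N.abs_angle_sub_le hY hYreg ht i
    rw [hY0] at h1
    have hΩ : 0 ≤ Ω := (abs_nonneg _).trans ((hYreg 0 ⟨le_rfl, ht.1.trans ht.2⟩).1 i)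
    have h2 : Ω * t ≤ Ω * T := mul_le_mul_of_nonneg_left (ht.2.trans hs.2) hΩ
    have := abs_le.1 h1
    exact ⟨by linarith, by linarith⟩
  have hF : ContDiffOn ℝ 1 N.field univ := N.contDiff_field.contDiffOn
  have hsolN : ∀ m : ℕ, ∃ X : ℝ → State n, X 0 = x₀ ∧ N.IsSolutionOn X (Icc 0 m) := fun m =>
    Literature.Analysis.ODE.exists_solution_of_confined isOpen_univ hF (hK m) (subset_univ _)
      (Nat.cast_nonneg m) (fun s hs Y hY0 hY => hconf m s hs Y hY0 hY)
  choose Xn hXn0 hXn using hsolN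
  have hagree : ∀ (m M : ℕ), m ≤ M → ∀ t ∈ Icc (0 : ℝ) m, Xn m t = Xn M t := by
    intro m M hmM t ht
    have hmM' : (m : ℝ) ≤ M := by exact_mod_cast hmM
    have hXM' : N.IsSolutionOn (Xn M) (Icc 0 m) := fun s hs =>
      (hXn M s ⟨hs.1, hs.2.trans hmM'⟩).mono (Icc_subset_Icc le_rfl hmM')
    exact N.solution_unique _ _ m (hXn m) hXM' (by rw [hXn0 m, hXn0 M]) t ht
  refine ⟨fun t => Xn ⌈t⌉₊ t, by simp [hXn0], fun T t ht => ?_⟩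
  have heq : EqOn (fun s : ℝ => Xn ⌈s⌉₊ s) (Xn ⌈T⌉₊) (Icc 0 T) := fun s hs =>
    hagree ⌈s⌉₊ ⌈T⌉₊ (Nat.ceil_mono hs.2) s ⟨hs.1, Nat.le_ceil s⟩
  have hder : HasDerivWithinAt (Xn ⌈T⌉₊) (N.field (Xn ⌈T⌉₊ t)) (Icc 0 T) t :=
    (hXn ⌈T⌉₊ t ⟨ht.1, ht.2.trans (Nat.le_ceil T)⟩).mono (Icc_subset_Icc le_rfl (Nat.le_ceil T))
  have ht' : Xn ⌈t⌉₊ t = Xn ⌈T⌉₊ t := heq ht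
  rw [show N.field (Xn ⌈t⌉₊ t) = N.field (Xn ⌈T⌉₊ t) by rw [ht']]
  exact hder.congr heq ht'

/-- **PROPOSITION 4.2 + completeness (lossy network): from EVERY state with positive voltages there
is exactly one forward-global motion of the lossy closed loop, and it stays in an admissible
region** — voltages `≥ r > 0` and `≤ ρ_i`, frequency deviations in `[−Ω, Ω]`, for all `t ≥ 0`
(«The set M … is invariant and all trajectories of (9), (1) are bounded» — general network with
transfer and shunt conductances, dominantly inductive susceptances, condition (12) `Q^u_i > 0`).
[cite: SchifferEtAl2014, §4 Proposition 4.2 with Assumption 4.1 and (12) («conditions for global boundedness are given for lossy microgrids», p0003 L7)] -/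
theorem exists_unique_globalSolution (hG : ∀ i j, N.G i j = N.G j i)
    (hB : ∀ i j, N.B i j = N.B j i) (hkP : ∀ i, 0 < N.kP i) (hτP : ∀ i, 0 < N.τP i)
    (hkQ : ∀ i, 0 < N.kQ i) (hτQ : ∀ i, 0 < N.τQ i) (hBoff : ∀ i j, i ≠ j → 0 ≤ N.B i j)
    (hBrow : ∀ i, ∑ j, N.B i j ≤ 0) (hQu : ∀ i, 0 < N.Qu i) (x₀ : State n)
    (h0 : ∀ i, 0 < x₀.2.2 i) :
    ∃ X : ℝ → State n, X 0 = x₀ ∧ (∀ T : ℝ, N.IsSolutionOn X (Icc 0 T)) ∧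
      (∀ Y : ℝ → State n, Y 0 = x₀ → (∀ T : ℝ, N.IsSolutionOn Y (Icc 0 T)) →
        ∀ t, 0 ≤ t → Y t = X t) ∧
      ∃ r Wb Ω : ℝ, N.Admissible r Wb Ω ∧ ∀ t, 0 ≤ t → X t ∈ N.region r Wb Ω := by
  obtain ⟨r, Wb, Ω, hadm, hx₀⟩ := N.exists_admissible hkP hkQ hτQ hQu x₀ h0
  obtain ⟨X, hX0, hX⟩ :=
    N.exists_globalSolution_of_mem_region hG hB hkP hτP hkQ hτQ hBoff hBrow hadm x₀ hx₀
  refine ⟨X, hX0, hX, fun Y hY0 hY t ht => ?_, r, Wb, Ω, hadm, fun t ht => ?_⟩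
  · exact N.solution_unique Y X t (hY t) (hX t) (by rw [hY0, hX0]) t ⟨ht, le_rfl⟩
  · exact N.region_invariant hG hB hkP hτP hkQ hτQ hBoff hBrow hadm (hX t) (by rw [hX0]; exact hx₀)
      t ⟨ht, le_rfl⟩

/-- **Every forward-global motion from positive voltages is bounded, with explicit bounds**
(Prop. 4.2 for a GIVEN motion): there are `r > 0` and admissible `(r, W̄, Ω)` with, for all
`t ≥ 0` and all `i`: `r ≤ V_i(t) ≤ ρ_i`, `|ω̃_i(t)| ≤ Ω`, `|P_i(t)| ≤ ρ_iβ_i`, `|Q_i(t)| ≤ ρ_iβ_i`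
(«V ∈ L_∞ … P ∈ L_∞ … ω ∈ L_∞»). [cite: SchifferEtAl2014, §4 Proposition 4.2 (proof, p0007 L29–L33)] -/
theorem exists_region_of_globalSolution (hG : ∀ i j, N.G i j = N.G j i)
    (hB : ∀ i j, N.B i j = N.B j i) (hkP : ∀ i, 0 < N.kP i) (hτP : ∀ i, 0 < N.τP i)
    (hkQ : ∀ i, 0 < N.kQ i) (hτQ : ∀ i, 0 < N.τQ i) (hBoff : ∀ i j, i ≠ j → 0 ≤ N.B i j)
    (hBrow : ∀ i, ∑ j, N.B i j ≤ 0) (hQu : ∀ i, 0 < N.Qu i) {X : ℝ → State n}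
    (hX : ∀ T : ℝ, N.IsSolutionOn X (Icc 0 T)) (h0 : ∀ i, 0 < (X 0).2.2 i) :
    ∃ r Wb Ω : ℝ, N.Admissible r Wb Ω ∧ ∀ t, 0 ≤ t → X t ∈ N.region r Wb Ω ∧
      ∀ i, r ≤ (X t).2.2 i ∧ (X t).2.2 i ≤ N.vcap Wb i ∧ |(X t).2.1 i| ≤ Ω ∧
        |N.P (X t).1 (X t).2.2 i| ≤ N.vcap Wb i * N.βL Wb i ∧
        |N.Q (X t).1 (X t).2.2 i| ≤ N.vcap Wb i * N.βL Wb i := by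
  obtain ⟨r, Wb, Ω, hadm, hx₀⟩ := N.exists_admissible hkP hkQ hτQ hQu (X 0) h0
  refine ⟨r, Wb, Ω, hadm, fun t ht => ?_⟩
  have hreg : X t ∈ N.region r Wb Ω :=
    N.region_invariant hG hB hkP hτP hkQ hτQ hBoff hBrow hadm (hX t) hx₀ t ⟨ht, le_rfl⟩
  have hVcap : ∀ j, 0 ≤ (X t).2.2 j ∧ (X t).2.2 j ≤ N.vcap Wb j :=
    N.voltage_le_vcap hkQ hτQ hadm.r_pos hreg
  refine ⟨hreg, fun i => ⟨hreg.2.1 i, (hVcap i).2, hreg.1 i, N.abs_P_le hVcap i, ?_⟩⟩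
  rw [N.Q_eq_mul_qred, abs_mul, abs_of_nonneg (hVcap i).1]
  exact mul_le_mul (hVcap i).2 (N.abs_qred_le hVcap i) (abs_nonneg _)
    ((hVcap i).1.trans (hVcap i).2)

/-! ## §5 Synchronized motions of the lossy closed loop and the synchronization frequency: the
active power LOSSES shift `ω_s` (Schiffer et al. (17), Remark 5.5 / (20), and the caveat of §5.4) -/

/-- **The total active power injection equals the network losses**
`Σ_i P_i(θ, V) = Σ_iΣ_j G_ij V_iV_j cos θ_ij` (the susceptance terms `B_ij V_iV_j sin θ_ij` cancel in
the sum: `B` symmetric, `sin` odd) — the lossy counterpart of «the well-known fact that in a lossless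
power system [Σ_i P_i = 0]». [cite: SchifferEtAl2014, Remark 5.5 (p0010 L11); ShinZavala2020, eq. (1a)] -/
theorem sum_P_eq (hB : ∀ i j, N.B i j = N.B j i) (θ V : Fin n → ℝ) :
    ∑ i, N.P θ V i = ∑ i, ∑ j, N.G i j * V i * V j * cos (θ i - θ j) := by
  set S : ℝ := ∑ i, ∑ j, V i * V j * N.B i j * sin (θ i - θ j) with hS
  have hS0 : S = 0 := by
    have hswap : S = -S :=
      calc S = ∑ j, ∑ i, V i * V j * N.B i j * sin (θ i - θ j) := by rw [hS, Finset.sum_comm]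
        _ = ∑ j, ∑ i, -(V j * V i * N.B j i * sin (θ j - θ i)) := by
          refine Finset.sum_congr rfl fun j _ => Finset.sum_congr rfl fun i _ => ?_
          rw [hB j i, show sin (θ j - θ i) = -sin (θ i - θ j) by rw [← Real.sin_neg, neg_sub]]
          ring
        _ = -S := by simp only [Finset.sum_neg_distrib, hS]
    linarith
  have h1 : ∑ i, N.P θ V i = ∑ i, ∑ j, N.G i j * V i * V j * cos (θ i - θ j) + S := by
    rw [hS, ← Finset.sum_add_distrib]
    refine Finset.sum_congr rfl fun i _ => ?_
    rw [P, ← Finset.sum_add_distrib]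
    exact Finset.sum_congr rfl fun j _ => by ring
  rw [h1, hS0, add_zero]

/-- **The losses are nonnegative for a bus CONDUCTANCE matrix of network type** (`G` symmetric,
`G_ij ≤ 0` for `i ≠ j` — transfer conductances `−g_ij` —, `Σ_j G_ij ≥ 0` — shunt conductances):
`Σ_iΣ_j G_ij V_iV_j cos θ_ij = Σ_i ĝ_i V_i² + ½Σ_{i≠j} g_ij(V_i² + V_j² − 2V_iV_j cos θ_ij) ≥ 0` (the
tree's `DroopPH.cosForm_nonpos` applied to `−G`). [cite: SchifferEtAl2014, §2 eq. (1) (generator reference arrow system) and §5.4 («the presence of small conductances»)] -/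
theorem losses_nonneg (hG : ∀ i j, N.G i j = N.G j i) (hGoff : ∀ i j, i ≠ j → N.G i j ≤ 0)
    (hGrow : ∀ i, 0 ≤ ∑ j, N.G i j) (θ V : Fin n → ℝ) :
    0 ≤ ∑ i, ∑ j, N.G i j * V i * V j * cos (θ i - θ j) := by
  -- the auxiliary lossless record with susceptance `−G`
  set M' : DroopPH n := { N.toDroopPH with B := fun i j => -N.G i j } with hM'
  have hB' : ∀ i j, M'.B i j = M'.B j i := fun i j => by simp only [hM', hG i j]
  have hBoff' : ∀ i j, i ≠ j → 0 ≤ M'.B i j := fun i j hij => by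
    simp only [hM']; linarith [hGoff i j hij]
  have hBrow' : ∀ i, ∑ j, M'.B i j ≤ 0 := fun i => by
    simp only [hM', Finset.sum_neg_distrib]; linarith [hGrow i]
  have h := M'.cosForm_nonpos hB' hBoff' hBrow' θ V
  have e : ∑ i, ∑ j, M'.B i j * cos (θ i - θ j) * V i * V j
      = -∑ i, ∑ j, N.G i j * V i * V j * cos (θ i - θ j) := by
    rw [← Finset.sum_neg_distrib]
    refine Finset.sum_congr rfl fun i _ => ?_
    rw [← Finset.sum_neg_distrib]
    exact Finset.sum_congr rfl fun j _ => by simp only [hM']; ring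
  rw [e] at h
  linarith

omit N in
/-- **The synchronized motion (17)** `x_s(t) = (θ* + ω_s t 𝟙, ω_s 𝟙, V*)`: all units rotate at the
common frequency deviation `ω_s` with fixed angle differences and voltages.
[cite: SchifferEtAl2014, §5.1 eq. (17) («synchronized motion and ω_s is the synchronization frequency»)] -/
def syncMotion (θs : Fin n → ℝ) (ωs : ℝ) (Vs : Fin n → ℝ) : ℝ → State n :=
  fun t => (fun i => θs i + ωs * t, fun _ => ωs, Vs)

/-- `P_i` along the synchronized motion is constant (angle differences are fixed). [cite: SchifferEtAl2014, §5.1] -/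
theorem P_syncMotion (θs : Fin n → ℝ) (ωs : ℝ) (Vs : Fin n → ℝ) (t : ℝ) :
    N.P (syncMotion θs ωs Vs t).1 Vs = N.P θs Vs := by
  ext i; simp [syncMotion, P, add_sub_add_right_eq_sub]

/-- `Q_i` along the synchronized motion is constant. [cite: SchifferEtAl2014, §5.1] -/
theorem Q_syncMotion (θs : Fin n → ℝ) (ωs : ℝ) (Vs : Fin n → ℝ) (t : ℝ) :
    N.Q (syncMotion θs ωs Vs t).1 Vs = N.Q θs Vs := by
  ext i; simp [syncMotion, Q, add_sub_add_right_eq_sub]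

/-- **The synchronized motion solves the lossy closed loop iff the power-flow equations of the
synchronized state hold**: `ω_s + k_Pi(P_i(θ*, V*) − P^u_i) = 0` and `V*_i + k_Qi(Q_i(θ*, V*) − Q^u_i)
= 0` for all `i` (`τ > 0`; «replacing the synchronized motion (17) in (7)»).
[cite: SchifferEtAl2014, §5.1 (17)–(19) and Remark 5.5] -/
theorem isSolutionOn_syncMotion_iff (hτP : ∀ i, 0 < N.τP i) (hτQ : ∀ i, 0 < N.τQ i)
    (θs : Fin n → ℝ) (ωs : ℝ) (Vs : Fin n → ℝ) :
    (∀ T : ℝ, N.IsSolutionOn (syncMotion θs ωs Vs) (Icc 0 T)) ↔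
      (∀ i, ωs + N.kP i * (N.P θs Vs i - N.Pu i) = 0) ∧
        ∀ i, Vs i + N.kQ i * (N.Q θs Vs i - N.Qu i) = 0 := by
  -- the velocity of the synchronized motion
  have hder : ∀ t : ℝ, HasDerivAt (syncMotion θs ωs Vs)
      ((fun _ => ωs, 0, 0) : State n) t := by
    intro t
    refine (hasDerivAt_pi.2 fun i => ?_).prodMk ((hasDerivAt_pi.2 fun i => ?_).prodMk
      (hasDerivAt_pi.2 fun i => ?_))
    · simpa using ((hasDerivAt_id t).const_mul ωs).const_add (θs i)
    · simpa using hasDerivAt_const t ωs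
    · simpa using hasDerivAt_const t (Vs i)
  -- the field along the synchronized motion
  have hfield : ∀ t, N.field (syncMotion θs ωs Vs t)
      = (fun _ => ωs, fun i => (-ωs - N.kP i * (N.P θs Vs i - N.Pu i)) / N.τP i,
          fun i => (-Vs i - N.kQ i * (N.Q θs Vs i - N.Qu i)) / N.τQ i) := by
    intro t
    have hP := N.P_syncMotion θs ωs Vs t
    have hQ := N.Q_syncMotion θs ωs Vs t
    simp only [syncMotion] at hP hQ ⊢
    simp only [field, hP, hQ]
  constructor
  · intro hsol
    have h1 : HasDerivWithinAt (syncMotion θs ωs Vs) (N.field (syncMotion θs ωs Vs 0))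
        (Icc 0 1) 0 := hsol 1 0 ⟨le_rfl, zero_le_one⟩
    have h2 : HasDerivWithinAt (syncMotion θs ωs Vs) ((fun _ => ωs, 0, 0) : State n)
        (Icc 0 1) 0 := (hder 0).hasDerivWithinAt
    have huniq : UniqueDiffWithinAt ℝ (Icc (0 : ℝ) 1) 0 :=
      uniqueDiffOn_Icc zero_lt_one 0 ⟨le_rfl, zero_le_one⟩
    have heq := huniq.eq_deriv _ h1 h2
    rw [hfield 0] at heq
    have hω : ∀ i, (-ωs - N.kP i * (N.P θs Vs i - N.Pu i)) / N.τP i = 0 := fun i => by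
      have := congrFun (congrArg (fun x : State n => x.2.1) heq) i
      simpa using this
    have hV : ∀ i, (-Vs i - N.kQ i * (N.Q θs Vs i - N.Qu i)) / N.τQ i = 0 := fun i => by
      have := congrFun (congrArg (fun x : State n => x.2.2) heq) i
      simpa using this
    refine ⟨fun i => ?_, fun i => ?_⟩
    · have h := hω i
      rw [div_eq_zero_iff, or_iff_left (hτP i).ne'] at h
      linarith
    · have h := hV i
      rw [div_eq_zero_iff, or_iff_left (hτQ i).ne'] at h
      linarith
  · rintro ⟨hω, hV⟩ T t _
    have h := (hder t).hasDerivWithinAt (s := Icc 0 T)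
    rw [hfield t]
    have e : ((fun _ => ωs, fun i => (-ωs - N.kP i * (N.P θs Vs i - N.Pu i)) / N.τP i,
        fun i => (-Vs i - N.kQ i * (N.Q θs Vs i - N.Qu i)) / N.τQ i) : State n)
        = ((fun _ => ωs, 0, 0) : State n) := by
      refine Prod.ext rfl (Prod.ext (funext fun i => ?_) (funext fun i => ?_))
      · show (-ωs - N.kP i * (N.P θs Vs i - N.Pu i)) / N.τP i = (0 : Fin n → ℝ) i
        rw [Pi.zero_apply, show -ωs - N.kP i * (N.P θs Vs i - N.Pu i) = 0 by linarith [hω i],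
          zero_div]
      · show (-Vs i - N.kQ i * (N.Q θs Vs i - N.Qu i)) / N.τQ i = (0 : Fin n → ℝ) i
        rw [Pi.zero_apply, show -Vs i - N.kQ i * (N.Q θs Vs i - N.Qu i) = 0 by linarith [hV i],
          zero_div]
    rw [e]
    exact h

/-- **THE SYNCHRONIZATION FREQUENCY OF THE LOSSY MICROGRID** («adding up all the nodes»): if the
synchronized motion `(θ* + ω_s t𝟙, ω_s𝟙, V*)` solves the lossy closed loop (`B` symmetric, `k_P,
τ > 0`), then
`ω_s · Σ_i k_Pi⁻¹ = Σ_i P^u_i − Σ_iΣ_j G_ij V*_iV*_j cos θ*_ij`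
— the lossless value `Σ_i P^u_i / Σ_i k_Pi⁻¹` of Remark 5.5 / (20) is LOWERED by the active power
losses of the synchronized state divided by `Σ_i k_Pi⁻¹` (the «small real nonzero constant» `ε` of
§5.4 made explicit). [cite: SchifferEtAl2014, Remark 5.5 and eq. (20) (p0010 L11–L15), §5.4 (p0013 L27–L30: «in the presence of small conductances, the synchronization frequency is given by …»)] -/
theorem syncFrequency_eq (hB : ∀ i j, N.B i j = N.B j i) (hkP : ∀ i, 0 < N.kP i)
    (hτP : ∀ i, 0 < N.τP i) (hτQ : ∀ i, 0 < N.τQ i) {θs : Fin n → ℝ} {ωs : ℝ} {Vs : Fin n → ℝ}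
    (hsol : ∀ T : ℝ, N.IsSolutionOn (syncMotion θs ωs Vs) (Icc 0 T)) :
    ωs * ∑ i, 1 / N.kP i = ∑ i, N.Pu i - ∑ i, ∑ j, N.G i j * Vs i * Vs j * cos (θs i - θs j) := by
  obtain ⟨hω, -⟩ := (N.isSolutionOn_syncMotion_iff hτP hτQ θs ωs Vs).1 hsol
  have h1 : ∀ i, ωs * (1 / N.kP i) = N.Pu i - N.P θs Vs i := fun i => by
    have h := hω i
    have hk := (hkP i).ne'
    field_simp
    linarith
  rw [Finset.mul_sum, Finset.sum_congr rfl fun i _ => h1 i, Finset.sum_sub_distrib, N.sum_P_eq hB]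

/-- **Lossless case** (`G = 0`): `ω_s = Σ_i P^u_i / Σ_i k_Pi⁻¹` — eq. (20) («it is possible to
uniquely determine ω_s»). [cite: SchifferEtAl2014, Remark 5.5, eq. (20)] -/
theorem syncFrequency_eq_of_G_eq_zero (hB : ∀ i j, N.B i j = N.B j i) (hkP : ∀ i, 0 < N.kP i)
    (hτP : ∀ i, 0 < N.τP i) (hτQ : ∀ i, 0 < N.τQ i) (hG : ∀ i j, N.G i j = 0) (hn : 0 < n)
    {θs : Fin n → ℝ} {ωs : ℝ} {Vs : Fin n → ℝ}
    (hsol : ∀ T : ℝ, N.IsSolutionOn (syncMotion θs ωs Vs) (Icc 0 T)) :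
    ωs = (∑ i, N.Pu i) / ∑ i, 1 / N.kP i := by
  haveI : Nonempty (Fin n) := ⟨⟨0, hn⟩⟩
  have hσ : 0 < ∑ i, 1 / N.kP i :=
    Finset.sum_pos (fun i _ => one_div_pos.2 (hkP i)) Finset.univ_nonempty
  have h := N.syncFrequency_eq hB hkP hτP hτQ hsol
  simp only [hG, zero_mul, Finset.sum_const_zero, sub_zero] at h
  rw [eq_div_iff hσ.ne', h]

/-- **The losses lower the synchronization frequency**: for a conductance matrix of network type
(`G` symmetric, `G_ij ≤ 0` off-diagonal, `Σ_j G_ij ≥ 0`) every synchronized motion of the lossy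
closed loop has `ω_s ≤ Σ_i P^u_i / Σ_i k_Pi⁻¹` (`n ≥ 1`); in particular, inputs balanced for the
lossless network (`Σ_i P^u_i = 0`, the tree's synchronous frame) give `ω_s ≤ 0`, with equality iff the
synchronized state is loss-free — the quantitative content of the caveat «In that case c_{1i} ≠ 0
under condition (38) and the proof of Corollary 5.12 is not applicable». [cite: SchifferEtAl2014, §5.4 (p0013 L27–L30), Remark 5.5] -/
theorem syncFrequency_le (hB : ∀ i j, N.B i j = N.B j i) (hkP : ∀ i, 0 < N.kP i)
    (hτP : ∀ i, 0 < N.τP i) (hτQ : ∀ i, 0 < N.τQ i) (hG : ∀ i j, N.G i j = N.G j i)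
    (hGoff : ∀ i j, i ≠ j → N.G i j ≤ 0) (hGrow : ∀ i, 0 ≤ ∑ j, N.G i j) (hn : 0 < n)
    {θs : Fin n → ℝ} {ωs : ℝ} {Vs : Fin n → ℝ}
    (hsol : ∀ T : ℝ, N.IsSolutionOn (syncMotion θs ωs Vs) (Icc 0 T)) :
    ωs ≤ (∑ i, N.Pu i) / ∑ i, 1 / N.kP i := by
  haveI : Nonempty (Fin n) := ⟨⟨0, hn⟩⟩
  have hσ : 0 < ∑ i, 1 / N.kP i :=
    Finset.sum_pos (fun i _ => one_div_pos.2 (hkP i)) Finset.univ_nonempty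
  have h := N.syncFrequency_eq hB hkP hτP hτQ hsol
  have hl := N.losses_nonneg hG hGoff hGrow θs Vs
  rw [le_div_iff₀ hσ, h]
  linarith

end DroopLossy

end Literature.MathematicalPhysics.PowerSystems
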